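import Literature.Computability.AlgebraicComplexity.AsymptoticSpectrum
import Literature.Computability.AlgebraicComplexity.TripartitionTensor
import Literature.Computability.FineGrained.SetCoverConjecture
import HarnessLib

/-!
# Pratt's bounds: balanced tripartitioning via `R̃(T_k)`, and the Set Cover price of low rank

Topic `Computability/AlgebraicComplexity`; named facts from

K. Pratt, *A stronger connection between the asymptotic rank conjecture and the set cover
conjecture*, Proc. 56th STOC (2024), 871–874 (arXiv:2311.02774) [Pratt2024SCC],

over the tree's vocabulary: the balanced tripartitioning tensors
`tripartitionTensor K k = T_k` (`TripartitionTensor.lean`, Pratt Def. 1.4), asymptotic rank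
`asymptoticRank` and tensor rank `tensorRank` (`AsymptoticSpectrum.lean`,
`MatrixMultiplicationExponent.lean`), and the word-RAM problems / hypotheses
`Literature.Computability.FineGrained.BalancedTripartitioning` (Pratt Problem 1.3),
`Literature.Computability.FineGrained.SetCoverConjecture` (Pratt Conj. 1.2 = Cygan et al.)
of `Literature/Computability/FineGrained/SetCoverConjecture.lean`.

> **Theorem 1.9.** For any `k ∈ ℕ` and `ε > 0`, there is a randomized algorithm for balanced
> tripartitioning with runtime `((R̃(T_k) + ε) · 27^k / (binom(3k,k) binom(2k,k)))^{n/k}`.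
>
> **Corollary 1.11.** If the set cover conjecture is true, then for every `ε > 0`, for all
> sufficiently large `k`, `R̃(T_k) > (8 − ε)^k`.
>
> **Corollary 1.12.** If the set cover conjecture is true, then for every `k`,
> `R(T_k) ≥ 8^k · binom(3k,k) binom(2k,k) / 27^k ≥ (2/9) · 8^k · k^{-1}`.

All three are vendored as NAMED FACTS (`def … : Prop`, cite-tagged, not proved here):
`pratt2024_thm_1_9`, `pratt2024_cor_1_11`, `pratt2024_cor_1_12`. Consumer: route
`MatrixMultiplication/TripartitionBridge` (its item `SccPrice` takes the conclusion of Cor. 1.11 as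
a hypothesis, with `T_k` inlined; `tripartitionTensor_def` is `rfl`).

## Design choices

* THE FIELD. Pratt: "Throughout `𝔽` denotes an arbitrary field. For our purposes one may assume
  without loss of generality that `𝔽 = ℚ` or `𝔽 = ℤ_p` (this will be due to [BCS]). We assume
  access to a `poly(n)`-time algorithm for arithmetic with `n`-bit elements in the prime field of
  `𝔽`" (§1.1), and in the proof of Thm. 1.9 "because asymptotic rank is invariant under field
  extension [BCS], we may assume that these field operations only involve … a constant-sized
  subset of the prime field". The facts are stated over `ℂ` (prime field `ℚ`), the field of the
  summit `MatrixMultiplication` and of the consuming route; this is an instance of the printed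
  "arbitrary field" statement, not a strengthening.
* RUNTIME SHAPE (Thm. 1.9). "Randomized algorithm with runtime `X(n)`" is rendered as
  `BalancedTripartitioning.RandInTimeO X` (randomised word RAM, success probability `≥ 2/3`,
  `C · X(n) + C` steps, `n` = the size measure of Problem 1.3). Pratt's proof pads `n` to the next
  multiple of `k` ("a negligibly larger universe") and absorbs `poly(n)` factors into `ε`
  (last display of the proof); both are covered by the `O`-constant and the quantifier `∀ ε > 0`.
  The exponent `n/k` is real division (`Real.rpow`); `k ≥ 1` excludes the junk case `k = 0`
  (`n/0 = 0`).
* Cor. 1.11 is rendered with "for all sufficiently large `k`" as `∃ k₀, ∀ k ≥ k₀`, strict `>` as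
  printed, and "for every `ε > 0`" as `0 < ε < 8` — see *Correction* below; Cor. 1.12 with `≥` as
  printed (its second, purely numerical inequality `binom(3k,k) binom(2k,k) ≥ (2/9) 27^k / k` is
  not restated here; it is PROVED in the companion file `PrattTripartitionBoundsProofs.lean`).
* Nothing here depends on the asymptotic rank conjecture; Cor. 1.10 (ARC ⇒ a
  `(3/2^{2/3} + ε)^n` algorithm for `s`-set cover) is not vendored as a statement (not
  requested), but the COMBINATORIAL CORE of its proof — the reduction from `s`-Set Cover to
  Balanced Tripartitioning, which is also the unprinted half of the proofs of Cor. 1.11 and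
  Cor. 1.12 — is PROVED below (namespace `SetCoverReduction`, see the section of the same name in
  this docstring).

## Correction (2026-08-15): the range of `ε` in Cor. 1.11

"For every `ε > 0` … `R̃(T_k) > (8 − ε)^k`" is the small-`ε` idiom: the claim strengthens as
`ε ↓ 0`, and read with `ε` unrestricted it is FALSE for `ε > 16` and even `k`
(`(8 − ε)^k = (ε − 8)^k > 8^k ≥ R̃(T_k)` by the paper's own `R(T_k) ≤ 8^k/2`, §1.2; in the tree by
the crude bound `R̃(T_k) ≤ 512^k`, `asymptoticRank_tripartitionTensor_le` below). The first
transcription of `pratt2024_cor_1_11` (2026-08) kept the literal unbounded quantifier,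
`SetCoverConjecture → ∀ ε > 0, ∃ k₀, ∀ k ≥ k₀, (8 − ε)^k < R̃(T_k)`, which is EQUIVALENT to
`¬ SetCoverConjecture` — kernel-checked in the companion file `PrattTripartitionBoundsProofs.lean`
(`not_forall_eps_eventually_pow_lt_asymptoticRank`: the literal conclusion is false outright;
`pratt2024_cor_1_11_literal_iff_not_setCoverConjecture`: the literal implication is equivalent
to `¬ SetCoverConjecture`) — hence undischargeable short of refuting the (open) Set Cover
Conjecture, and contradictory in combination with the hypothesis `SetCoverConjecture` under which
every consumer uses it. The definition below is the CORRECTED transcription (same cite):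
`SetCoverConjecture → ∀ ε, 0 < ε → ε < 8 → ∃ k₀, ∀ k ≥ k₀, (8 − ε)^k < R̃(T_k)`
[cite: Pratt2024SCC, Cor. 1.11]. Nothing printed is lost: equivalently the corollary says that
every base `b ∈ [0, 8)` is eventually beaten (`pratt2024_cor_1_11.eventually_lt`); for
`8 ≤ ε < 16` the printed inequality follows for all large `k` from the case of the base
`|8 − ε| ∈ [0, 8)` (`pratt2024_cor_1_11.of_le_sixteen`); and for `ε ≥ 16` it is the false
reading above. Its proof — not printed, "a more-or-less immediate consequence of Thm. 1.9" — is
the contrapositive through Thm. 1.9 and the reduction from `s`-Set Cover to Balanced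
Tripartitioning of the proof of Cor. 1.10 (§2, pp. 6–7): `R̃(T_k) ≤ (8 − ε)^k` for one large `k`
gives randomised `2^{(1−δ)n}`-time algorithms for EVERY `s`-Set Cover with one `δ = δ(ε) > 0`;
the companion file proves exactly the corrected statement from `pratt2024_thm_1_9` and that
hardness step taken as a hypothesis (`pratt2024_cor_1_11_printed_of_hardness`, via Cor. 1.12's
bound and `k · ((8 − ε)/8)^k → 0`). Consumers by name at the time of the correction: only the
glue lemmas below (adapted) and the companion file; the consuming route's item `SccPrice`
inlines the literal (false) conclusion `∀ ε > 0, ∃ k₀, …` and is vacuous until re-filed in the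
corrected form (`0 < ε → ε < 8 → …`, or `∀ b, 0 ≤ b → b < 8 → ∃ k₀, ∀ k ≥ k₀, b^k < R̃(T_k)`).

## The reduction `s`-Set Cover → Balanced Tripartitioning (2026-08-15)

The proof of Cor. 1.10 (§2, pp. 6–7 of the arXiv version) reduces `s`-Set Cover on `[n]` with
budget `t` to `poly(n)` instances of Balanced Tripartitioning on universes `[n] ∖ S`, `|S| = 3s`;
the same reduction, run contrapositively through Thm. 1.9, is the unprinted proof of Cor. 1.11
and Cor. 1.12 (the hypothesis `hBT` of `pratt2024_cor_1_11_of_hardness` /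
`pratt2024_cor_1_12_of_hardness` in the companion file, i.e. the second half of the discharge
path of `pratt2024_cor_1_11` next to `pratt2024_thm_1_9`). Its word-RAM implementation (dynamic
programming over the `≤ binom(n, n/3) · poly(n)` unions, `poly(n)` oracle calls, success
amplification) is not formalized here; its
COMBINATORIAL CORRECTNESS — the claims the source states without proof — is, over an arbitrary
finite ground set `U : Finset α` and a family `F` of subsets of `U` of size `≤ s`
(namespace `SetCoverReduction`):

* `downClosure F` = `F' := ⋃_{X ∈ F} 2^X` and `exists_cover_iff_exists_pairwiseDisjoint`:
  "`F` contains at most `t` sets covering `[n]` if and only if `F'` contains at most `t` sets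
  partitioning `[n]`" (disjointification `X_i ∖ ⋃_{j<i} X_j`, resp. choosing supersets);
* `exists_balanced_three_blocks`: "for any partition `X_1 ⊔ ⋯ ⊔ X_m = [n]` with `|X_i| ≤ s`
  there exists a partition `A ⊔ B ⊔ C = [m]` such that
  `⌊n/3⌋ − s ≤ |⊔_{a ∈ A} X_a| ≤ ⌊n/3⌋ + s`, and similarly with `B` and `C`" (prefix sums with
  increments `≤ s` cross every threshold within `s − 1`: `exists_subfamily_le_card_biUnion_lt`,
  applied twice with a corrected second threshold; lower bounds are written `⌊n/3⌋ ≤ |·| + s`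
  in `ℕ`);
* `disjUnions F' m` = `F'_m` ("all unions of all pairwise disjoint collections of `m` subsets in
  `F'`") and `exists_cover_iff_exists_balanced_disjUnions`: "it now suffices to check for every
  `(t₁, t₂, t₃)` with `t₁ + t₂ + t₃ ≤ t` if there exist `X ∈ F'_{t₁}, Y ∈ F'_{t₂}, Z ∈ F'_{t₃}`
  partitioning `[n]`" — with the three parts balanced as above, which is what lets the dynamic
  programme keep only unions of size `≤ n/3 + s` (`balancedDisjUnions`, the pruned `F'_t`);
* `boundaryFamily F U s t S S_i` = `F''_{t,S}` (component `i`: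
  `{X ∖ S_i : X ∈ F'_t, |X| = n/3 − s + |S_i|, X ∩ S = S_i}`), whose members are
  `(n/3 − s)`-subsets of `U ∖ S` (`card_eq_of_mem_boundaryFamily`,
  `subset_of_mem_boundaryFamily`: a well-formed Balanced Tripartitioning instance on the
  universe `[n] ∖ S` of size `3 (n/3 − s)`), and `exists_cover_iff_exists_boundary_tripartition`:
  "if there were sets in `F'_{t₁}, F'_{t₂}, F'_{t₃}` partitioning `[n]`, then there exists an `S`
  such that `F''_{t₁,S}, F''_{t₂,S}, F''_{t₃,S}` contains a balanced tripartition of `[n] ∖ S`,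
  and conversely" — end to end: `F` has a cover by `≤ t` sets iff for some `t₁ + t₂ + t₃ ≤ t`,
  some `S ⊆ U` with `|S| = 3s` and some ordered partition `S = S₁ ⊔ S₂ ⊔ S₃`, three members of
  the three boundary families cover `U ∖ S`. Here `3 ∣ n` and `3s ≤ n` are assumed (the source
  tacitly works with `n/3 ∈ ℕ`; Balanced Tripartitioning lives on universes `[3n']`, and a user
  pads the ground set by `≤ 2` fresh points).

## References

* [Pratt2024SCC] K. Pratt, STOC 2024, doi:10.1145/3618260.3649620, arXiv:2311.02774 — Thm. 1.9,
  Cor. 1.11, Cor. 1.12 (p. 4), proofs §2 (pp. 6–7; the reduction: proof of Cor. 1.10).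
* [BjorklundKaski2024] A. Björklund, P. Kaski, *The asymptotic rank conjecture and the set cover
  conjecture are not both true*, STOC 2024 — the earlier, weaker form of the connection.
-/

noncomputable section

namespace Literature.Computability.AlgebraicComplexity

open FineGrained

/-- The base of Pratt's running time for balanced tripartitioning with block size `k`:
`b_k(ε) = (R̃(T_k) + ε) · 27^k / (binom(3k,k) · binom(2k,k))`, with `R̃` the asymptotic rank over
`ℂ`. [cite: Pratt2024SCC, Thm. 1.9] -/
def prattBase (k : ℕ) (ε : ℝ) : ℝ :=
  (asymptoticRank (tripartitionTensor ℂ k) + ε) * 27 ^ k / ((3 * k).choose k * (2 * k).choose k)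

/-- Unfolding lemma for `prattBase`. [cite: Pratt2024SCC, Thm. 1.9] -/
theorem prattBase_def (k : ℕ) (ε : ℝ) :
    prattBase k ε = (asymptoticRank (tripartitionTensor ℂ k) + ε) * 27 ^ k /
      ((3 * k).choose k * (2 * k).choose k) :=
  rfl

/-- `b_k(ε) > 0` for `ε > 0` (`R̃ ≥ 0`, binomials positive). [folklore] -/
theorem prattBase_pos (k : ℕ) {ε : ℝ} (hε : 0 < ε) : 0 < prattBase k ε := by
  rw [prattBase_def]
  have h0 : 0 ≤ asymptoticRank (tripartitionTensor ℂ k) := asymptoticRank_nonneg _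
  have h1 : (0 : ℝ) < (3 * k).choose k := by exact_mod_cast Nat.choose_pos (by omega)
  have h2 : (0 : ℝ) < (2 * k).choose k := by exact_mod_cast Nat.choose_pos (by omega)
  positivity

/-- **Pratt, Theorem 1.9** (STOC 2024): for every `k ≥ 1` and `ε > 0` there is a randomised
algorithm for Balanced Tripartitioning (Problem 1.3, `FineGrained.BalancedTripartitioning`, size
measure `n`) with running time `O(b_k(ε)^{n/k})`,
`b_k(ε) = (R̃(T_k) + ε) · 27^k / (binom(3k,k) binom(2k,k))` (`prattBase`, asymptotic rank over
`ℂ`), on the randomised word RAM with success probability `≥ 2/3` (`RandInTimeO`). A named fact,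
not proved here (random relabelling, Schwartz–Zippel, and fast evaluation of `T_k^{⊗r}` from a
rank decomposition of a fixed power, §2 of the source). [cite: Pratt2024SCC, Thm. 1.9] -/
def pratt2024_thm_1_9 : Prop :=
  ∀ k : ℕ, 1 ≤ k → ∀ ε : ℝ, 0 < ε →
    BalancedTripartitioning.RandInTimeO fun n : ℕ => prattBase k ε ^ ((n : ℝ) / k)

/-- **Pratt, Corollary 1.11** (STOC 2024): "If the set cover conjecture is true, then for every
`ε > 0`, for all sufficiently large `k`, `R̃(T_k) > (8 − ε)^k`" — with
`FineGrained.SetCoverConjecture` (Pratt Conj. 1.2), asymptotic rank over `ℂ`, "for all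
sufficiently large `k`" as `∃ k₀, ∀ k ≥ k₀`, and the printed "every `ε > 0`" in its meaningful
range `0 < ε < 8` (the small-`ε` idiom: for `ε > 16` and even `k` the literal inequality is false,
see the module docstring, *Correction (2026-08-15)* — the first transcription, without `ε < 8`,
was equivalent to `¬ SetCoverConjecture`). A named fact, not proved here (Thm. 1.9 plus the
reduction from `s`-Set Cover to Balanced Tripartitioning in the proof of Cor. 1.10; the companion
file proves it from `pratt2024_thm_1_9` and that reduction taken as a hypothesis,
`pratt2024_cor_1_11_printed_of_hardness`). [cite: Pratt2024SCC, Cor. 1.11] -/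
def pratt2024_cor_1_11 : Prop :=
  SetCoverConjecture → ∀ ε : ℝ, 0 < ε → ε < 8 → ∃ k₀ : ℕ, ∀ k : ℕ, k₀ ≤ k →
    ((8 : ℝ) - ε) ^ k < asymptoticRank (tripartitionTensor ℂ k)

/-- **Pratt, Corollary 1.12** (STOC 2024): "If the set cover conjecture is true, then for every
`k`, `R(T_k) ≥ 8^k · binom(3k,k) binom(2k,k) / 27^k`" (tensor rank over `ℂ`; the printed further
bound `≥ (2/9) · 8^k / k` is arithmetic and not restated). A named fact, not proved here.
[cite: Pratt2024SCC, Cor. 1.12] -/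
def pratt2024_cor_1_12 : Prop :=
  SetCoverConjecture → ∀ k : ℕ,
    (8 : ℝ) ^ k * ((3 * k).choose k * (2 * k).choose k) / 27 ^ k ≤
      (tensorRank (tripartitionTensor ℂ k) : ℝ)

/-! ### Glue for the consuming route -/

/-- `pratt2024_cor_1_11` in the inlined spelling of `T_k` used by route
`MatrixMultiplication/TripartitionBridge` (the route writes the tensor as a lambda;
`tripartitionTensor_def`), for `0 < ε < 8`. [cite: Pratt2024SCC, Cor. 1.11] -/
theorem pratt2024_cor_1_11.inlined (h : pratt2024_cor_1_11) (hscc : SetCoverConjecture) :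
    ∀ ε : ℝ, 0 < ε → ε < 8 → ∃ k₀ : ℕ, ∀ k : ℕ, k₀ ≤ k → ((8 : ℝ) - ε) ^ k <
      asymptoticRank (fun S T U : {A : Finset (Fin (3 * k)) // A.card = k} =>
        if Disjoint S.1 T.1 ∧ Disjoint S.1 U.1 ∧ Disjoint T.1 U.1 then (1 : ℂ) else 0) :=
  h hscc

/-- Under `pratt2024_cor_1_11` and the Set Cover Conjecture every base `b ∈ [0, 8)` is eventually
beaten: `b^k < R̃(T_k)` for all large `k` (`7.99^k`, say; for `b < 1` compare with `b = 1`,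
i.e. `ε = 7`). This base form is equivalent to the corollary. [cite: Pratt2024SCC, Cor. 1.11] -/
theorem pratt2024_cor_1_11.eventually_lt (h : pratt2024_cor_1_11) (hscc : SetCoverConjecture)
    {b : ℝ} (hb₀ : 0 ≤ b) (hb : b < 8) :
    ∃ k₀ : ℕ, ∀ k : ℕ, k₀ ≤ k → b ^ k < asymptoticRank (tripartitionTensor ℂ k) := by
  have hm8 : max b 1 < 8 := max_lt hb (by norm_num)
  have hm1 : (1 : ℝ) ≤ max b 1 := le_max_right b 1
  obtain ⟨k₀, hk₀⟩ := h hscc (8 - max b 1) (by linarith) (by linarith)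
  refine ⟨k₀, fun k hk => ?_⟩
  have h1 : b ^ k ≤ (max b 1) ^ k := pow_le_pow_left₀ hb₀ (le_max_left b 1) k
  have h2 := hk₀ k hk
  rw [sub_sub_cancel] at h2
  exact h1.trans_lt h2

/-! ### The crude bound behind the correction

`R̃(T_k) ≤ 512^k` for all `k`, the tree form of "`(8 − ε)^k` cannot stay below `R̃(T_k)` for
`ε > 16`"; the refutation of the literal reading of Cor. 1.11 built on it lives in the companion
file `PrattTripartitionBoundsProofs.lean` (which inlines the bound for even `k`). -/

/-- Crude upper bound `R̃(T_k) ≤ 512^k`: `R̃(t) ≤ R(t^{⊗1}) ≤ |ι|³` for the format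
`ι = (Fin 1 → binom([3k],k))` of `T_k^{⊗1}` (`asymptoticRank_le_tensorRank_pow_one`,
`tensorRank_le_card`), and `|binom([3k],k)| ≤ |Finset (Fin 3k)| = 2^{3k} = 8^k`. [folklore] -/
theorem asymptoticRank_tripartitionTensor_le (k : ℕ) :
    asymptoticRank (tripartitionTensor ℂ k) ≤ (512 : ℝ) ^ k := by
  classical
  have h1 := asymptoticRank_le_tensorRank_pow_one (tripartitionTensor ℂ k)
  have h2 := tensorRank_le_card (kroneckerPow (tripartitionTensor ℂ k) 1)
  have hι : Fintype.card (Fin 1 → TripartitionIndex k) ≤ 8 ^ k := by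
    rw [Fintype.card_fun, Fintype.card_fin, pow_one]
    calc Fintype.card (TripartitionIndex k)
        ≤ Fintype.card (Finset (Fin (3 * k))) := Fintype.card_subtype_le _
      _ = 8 ^ k := by rw [Fintype.card_finset, Fintype.card_fin, pow_mul]; norm_num
  have h3 : tensorRank (kroneckerPow (tripartitionTensor ℂ k) 1) ≤ 512 ^ k := by
    refine h2.trans ?_
    calc Fintype.card (Fin 1 → TripartitionIndex k) * Fintype.card (Fin 1 → TripartitionIndex k) *
          Fintype.card (Fin 1 → TripartitionIndex k)
        ≤ 8 ^ k * 8 ^ k * 8 ^ k :=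
          Nat.mul_le_mul (Nat.mul_le_mul hι hι) hι
      _ = 512 ^ k := by rw [← mul_pow, ← mul_pow]; norm_num
  calc asymptoticRank (tripartitionTensor ℂ k)
      ≤ (tensorRank (kroneckerPow (tripartitionTensor ℂ k) 1) : ℝ) := h1
    _ ≤ ((512 ^ k : ℕ) : ℝ) := by exact_mod_cast h3
    _ = (512 : ℝ) ^ k := by push_cast; rfl

/-- The corrected corollary loses nothing of the printed one for `8 ≤ ε < 16` either: there
`(8 − ε)^k ≤ |8 − ε|^k = (8 − (16 − ε))^k` with `0 < 16 − ε ≤ 8`, so the inequality for such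
`ε` and all large `k ≥ 1` follows from the case of a base in `[0, 8)`
(`pratt2024_cor_1_11.eventually_lt`). [cite: Pratt2024SCC, Cor. 1.11] -/
theorem pratt2024_cor_1_11.of_le_sixteen (h : pratt2024_cor_1_11) (hscc : SetCoverConjecture)
    {ε : ℝ} (hε : 0 < ε) (hε16 : ε < 16) :
    ∃ k₀ : ℕ, ∀ k : ℕ, k₀ ≤ k → ((8 : ℝ) - ε) ^ k < asymptoticRank (tripartitionTensor ℂ k) := by
  obtain ⟨k₀, hk₀⟩ := pratt2024_cor_1_11.eventually_lt h hscc (abs_nonneg (8 - ε))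
    (abs_sub_lt_iff.2 ⟨by linarith, by linarith⟩)
  refine ⟨k₀, fun k hk => ?_⟩
  have h1 := hk₀ k hk
  rw [← abs_pow] at h1
  exact (le_abs_self _).trans_lt h1

/-! ### The reduction `s`-Set Cover → Balanced Tripartitioning (proof of Cor. 1.10): the
combinatorial core, proved

See the module docstring, section *The reduction `s`-Set Cover → Balanced Tripartitioning*.
Everything below is over an arbitrary type `α` with decidable equality, a finite ground set
`U : Finset α` and finite families `F, G, H : Finset (Finset α)`; unions of families are
`Finset.biUnion · id`. -/

namespace SetCoverReduction

variable {α : Type*} [DecidableEq α]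

/-- The downward closure `F' := ⋃_{X ∈ F} 2^X` of a finite set family ("Given set family `𝓕`,
first construct its downwards closure", proof of Cor. 1.10, p. 6).
[cite: Pratt2024SCC, proof of Cor. 1.10] -/
def downClosure (F : Finset (Finset α)) : Finset (Finset α) :=
  F.biUnion Finset.powerset

/-- `Y ∈ F'` iff `Y ⊆ X` for some `X ∈ F`. [folklore] -/
theorem mem_downClosure {F : Finset (Finset α)} {Y : Finset α} :
    Y ∈ downClosure F ↔ ∃ X ∈ F, Y ⊆ X := by
  simp [downClosure]

/-- The downward closure is monotone. [folklore] -/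
theorem downClosure_mono {F G : Finset (Finset α)} (h : F ⊆ G) :
    downClosure F ⊆ downClosure G :=
  Finset.biUnion_subset_biUnion_of_subset_left _ h

/-- `F ⊆ F'`. [folklore] -/
theorem mem_downClosure_of_mem {F : Finset (Finset α)} {X : Finset α} (hX : X ∈ F) :
    X ∈ downClosure F :=
  mem_downClosure.2 ⟨X, hX, Finset.Subset.refl X⟩

/-- If the members of `F` have size `≤ s`, so do the members of `F'`. [folklore] -/
theorem card_le_of_mem_downClosure {F : Finset (Finset α)} {s : ℕ} (hF : ∀ X ∈ F, X.card ≤ s)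
    {Y : Finset α} (hY : Y ∈ downClosure F) : Y.card ≤ s := by
  obtain ⟨X, hX, hYX⟩ := mem_downClosure.1 hY
  exact (Finset.card_le_card hYX).trans (hF X hX)

open scoped Classical in
/-- `G_m`: the unions of the pairwise disjoint collections of exactly `m` members of `G` (for
`G = F'`: "for each `m ≤ t`, compute all unions of all pairwise disjoint collections of `m`
subsets in `𝓕'`", proof of Cor. 1.10, p. 6; the size pruning is `balancedDisjUnions` below).
[cite: Pratt2024SCC, proof of Cor. 1.10] -/
def disjUnions (G : Finset (Finset α)) (m : ℕ) : Finset (Finset α) :=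
  ((G.powersetCard m).filter fun H : Finset (Finset α) =>
      (↑H : Set (Finset α)).PairwiseDisjoint id).image fun H => H.biUnion id

/-- Membership in `disjUnions G m`, unfolded. [folklore] -/
theorem mem_disjUnions {G : Finset (Finset α)} {m : ℕ} {X : Finset α} :
    X ∈ disjUnions G m ↔ ∃ H ⊆ G, H.card = m ∧ (H : Set (Finset α)).PairwiseDisjoint id ∧
      H.biUnion id = X := by
  classical
  simp only [disjUnions, Finset.mem_image, Finset.mem_filter, Finset.mem_powersetCard]
  constructor
  · rintro ⟨H, ⟨⟨hHG, hcard⟩, hd⟩, rfl⟩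
    exact ⟨H, hHG, hcard, hd, rfl⟩
  · rintro ⟨H, hHG, hcard, hd, rfl⟩
    exact ⟨H, ⟨⟨hHG, hcard⟩, hd⟩, rfl⟩

/-- Disjointification: every finite family `G` has a pairwise disjoint family `H ⊆ G'` (the
downward closure) with at most as many members and the same union — order `G = {X_1, …, X_m}`
and take the `X_i ∖ ⋃_{j<i} X_j` (here: induction on `G`). [folklore] -/
theorem exists_pairwiseDisjoint_refinement (G : Finset (Finset α)) :
    ∃ H ⊆ downClosure G, H.card ≤ G.card ∧ (H : Set (Finset α)).PairwiseDisjoint id ∧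
      H.biUnion id = G.biUnion id := by
  classical
  induction G using Finset.induction_on with
  | empty => exact ⟨∅, Finset.empty_subset _, le_rfl, by simp, rfl⟩
  | insert X G₀ hX ih =>
    obtain ⟨H₀, hH₀, hcard, hd, hU⟩ := ih
    refine ⟨insert (X \ G₀.biUnion id) H₀, ?_, ?_, ?_, ?_⟩
    · intro Y hY
      rw [Finset.mem_insert] at hY
      rcases hY with rfl | hY
      · exact mem_downClosure.2 ⟨X, Finset.mem_insert_self _ _, Finset.sdiff_subset⟩
      · exact downClosure_mono (Finset.subset_insert _ _) (hH₀ hY)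
    · calc (insert (X \ G₀.biUnion id) H₀).card ≤ H₀.card + 1 := Finset.card_insert_le _ _
        _ ≤ G₀.card + 1 := by omega
        _ = (insert X G₀).card := (Finset.card_insert_of_notMem hX).symm
    · rw [Finset.coe_insert]
      refine hd.insert fun Z hZ _ => ?_
      have hZ' : Z ⊆ G₀.biUnion id := hU ▸ Finset.subset_biUnion_of_mem id hZ
      exact Finset.disjoint_of_subset_right hZ' Finset.sdiff_disjoint
    · rw [Finset.biUnion_insert, hU, Finset.biUnion_insert, id_eq, id_eq]
      exact Finset.sdiff_union_self_eq_union

/-- Conversely, a subfamily `H ⊆ F'` with union `U` yields at most `|H|` members of `F` with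
union `U` (replace each member of `H` by a member of `F` containing it; all members of `F` lie
in `U`). [folklore] -/
theorem exists_cover_of_subfamily_downClosure {F H : Finset (Finset α)} {U : Finset α}
    (hF : ∀ X ∈ F, X ⊆ U) (hH : H ⊆ downClosure F) (hHU : H.biUnion id = U) :
    ∃ G ⊆ F, G.card ≤ H.card ∧ G.biUnion id = U := by
  classical
  have hch : ∀ Y ∈ H, ∃ X ∈ F, Y ⊆ X := fun Y hY => mem_downClosure.1 (hH hY)
  choose f hfF hYf using hch
  refine ⟨H.attach.image fun Y => f Y.1 Y.2, ?_, ?_, ?_⟩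
  · intro X hX
    obtain ⟨Y, -, rfl⟩ := Finset.mem_image.1 hX
    exact hfF Y.1 Y.2
  · exact Finset.card_image_le.trans (by rw [Finset.card_attach])
  · apply Finset.Subset.antisymm
    · exact Finset.biUnion_subset.2 fun X hX => by
        obtain ⟨Y, -, rfl⟩ := Finset.mem_image.1 hX
        exact hF _ (hfF Y.1 Y.2)
    · rw [← hHU]
      refine Finset.biUnion_subset.2 fun Y hY => ?_
      have hmem : f Y hY ∈ H.attach.image fun Y => f Y.1 Y.2 :=
        Finset.mem_image.2 ⟨⟨Y, hY⟩, Finset.mem_attach _ _, rfl⟩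
      exact (hYf Y hY).trans (Finset.subset_biUnion_of_mem id hmem)

/-- **Pratt, proof of Cor. 1.10, first claim**: "Note that `𝓕` contains at most `t` sets
covering `[n]` if and only if `𝓕'` contains at most `t` sets partitioning `[n]`" — for a family
`F` of subsets of a finite ground set `U` and its downward closure `F' = downClosure F`.
[cite: Pratt2024SCC, proof of Cor. 1.10] -/
theorem exists_cover_iff_exists_pairwiseDisjoint (F : Finset (Finset α)) {U : Finset α}
    (hF : ∀ X ∈ F, X ⊆ U) (t : ℕ) :
    (∃ G ⊆ F, G.card ≤ t ∧ G.biUnion id = U) ↔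
      ∃ H ⊆ downClosure F, H.card ≤ t ∧ (H : Set (Finset α)).PairwiseDisjoint id ∧
        H.biUnion id = U := by
  constructor
  · rintro ⟨G, hGF, hGt, hGU⟩
    obtain ⟨H, hH, hcard, hd, hU⟩ := exists_pairwiseDisjoint_refinement G
    exact ⟨H, hH.trans (downClosure_mono hGF), hcard.trans hGt, hd, hU.trans hGU⟩
  · rintro ⟨H, hH, hHt, -, hHU⟩
    obtain ⟨G, hGF, hcard, hGU⟩ := exists_cover_of_subfamily_downClosure hF hH hHU
    exact ⟨G, hGF, hcard.trans hHt, hGU⟩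

/-- Threshold crossing: if the members of `H` have size `≤ s` (`s ≥ 1`), then for every
`θ ≤ |⋃ H|` some subfamily `A ⊆ H` has `θ ≤ |⋃ A| < θ + s` (add members one at a time: the
union grows by at most `s` per step). [folklore] -/
theorem exists_subfamily_le_card_biUnion_lt (H : Finset (Finset α)) {s : ℕ} (hs : 0 < s)
    (hH : ∀ X ∈ H, X.card ≤ s) {θ : ℕ} (hθ : θ ≤ (H.biUnion id).card) :
    ∃ A ⊆ H, θ ≤ (A.biUnion id).card ∧ (A.biUnion id).card < θ + s := by
  classical
  induction H using Finset.induction_on with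
  | empty =>
    have hθ0 : θ = 0 := by simpa using hθ
    exact ⟨∅, Finset.Subset.refl _, hθ, by simp [hθ0, hs]⟩
  | insert X H₀ hX ih =>
    by_cases hle : θ ≤ (H₀.biUnion id).card
    · obtain ⟨A, hA, h1, h2⟩ := ih (fun Y hY => hH Y (Finset.mem_insert_of_mem hY)) hle
      exact ⟨A, hA.trans (Finset.subset_insert _ _), h1, h2⟩
    · refine ⟨insert X H₀, Finset.Subset.refl _, hθ, ?_⟩
      have hXs := hH X (Finset.mem_insert_self _ _)
      rw [Finset.biUnion_insert, id_eq]
      calc (X ∪ H₀.biUnion id).card ≤ X.card + (H₀.biUnion id).card := Finset.card_union_le _ _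
        _ < θ + s := by omega

/-- **Pratt, proof of Cor. 1.10, the balancing claim**: "for any partition
`X_1 ⊔ ⋯ ⊔ X_m = [n]` with `|X_i| ≤ s`, there exists a partition `A ⊔ B ⊔ C = [m]` such that
`⌊n/3⌋ − s ≤ |⊔_{a ∈ A} X_a| ≤ ⌊n/3⌋ + s`, and similarly with the sets indexed by `B` and `C`."
Here `H` is the (pairwise disjoint) family `{X_i}`, `n = |⋃ H|`, `⌊n/3⌋ = n / 3`, and the lower
bounds are written `n / 3 ≤ |⋃ A| + s` in `ℕ`. Proof: `A` is a threshold crossing at `n/3`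
(`n/3 ≤ |⋃ A| ≤ n/3 + s − 1`), `B ⊆ H ∖ A` one at `n − |⋃ A| − n/3 − [n mod 3 = 2]`, `C` the rest;
`s = 0` (all parts empty) separately. [cite: Pratt2024SCC, proof of Cor. 1.10] -/
theorem exists_balanced_three_blocks (H : Finset (Finset α)) (s : ℕ)
    (hH : ∀ X ∈ H, X.card ≤ s) (hd : (H : Set (Finset α)).PairwiseDisjoint id) :
    ∃ A B C : Finset (Finset α), A ⊆ H ∧ B ⊆ H ∧ C ⊆ H ∧
      Disjoint A B ∧ Disjoint A C ∧ Disjoint B C ∧ A ∪ B ∪ C = H ∧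
      ((H.biUnion id).card / 3 ≤ (A.biUnion id).card + s ∧
        (A.biUnion id).card ≤ (H.biUnion id).card / 3 + s) ∧
      ((H.biUnion id).card / 3 ≤ (B.biUnion id).card + s ∧
        (B.biUnion id).card ≤ (H.biUnion id).card / 3 + s) ∧
      ((H.biUnion id).card / 3 ≤ (C.biUnion id).card + s ∧
        (C.biUnion id).card ≤ (H.biUnion id).card / 3 + s) := by
  classical
  -- `D ↦ |⋃ D|` is additive on subfamilies of the pairwise disjoint family `H`
  have hw : ∀ D ⊆ H, (D.biUnion id).card = ∑ X ∈ D, X.card := fun D hD =>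
    Finset.card_biUnion (hd.subset (Finset.coe_subset.2 hD))
  rcases Nat.eq_zero_or_pos s with rfl | hs
  · -- `s = 0`: every member is empty
    have h0 : (H.biUnion id).card = 0 := by
      rw [hw H (Finset.Subset.refl _)]
      exact Finset.sum_eq_zero fun X hX => Nat.eq_zero_of_le_zero (hH X hX)
    refine ⟨∅, ∅, H, Finset.empty_subset _, Finset.empty_subset _, Finset.Subset.refl _,
      disjoint_bot_left, disjoint_bot_left, disjoint_bot_left, by simp, ?_⟩
    simp [h0]
  · obtain ⟨A, hA, hA1, hA2⟩ := exists_subfamily_le_card_biUnion_lt H hs hH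
      (Nat.div_le_self (H.biUnion id).card 3)
    have hsumA : ∑ X ∈ H \ A, X.card + ∑ X ∈ A, X.card = ∑ X ∈ H, X.card := Finset.sum_sdiff hA
    have hHA : ((H \ A).biUnion id).card = (H.biUnion id).card - (A.biUnion id).card := by
      rw [hw _ Finset.sdiff_subset, hw A hA, hw H (Finset.Subset.refl _)]
      omega
    obtain ⟨B, hB, hB1, hB2⟩ := exists_subfamily_le_card_biUnion_lt (H \ A) hs
      (fun X hX => hH X (Finset.sdiff_subset hX))
      (θ := (H.biUnion id).card - (A.biUnion id).card - (H.biUnion id).card / 3 -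
        (H.biUnion id).card % 3 / 2) (by rw [hHA]; omega)
    have hBH : B ⊆ H := hB.trans Finset.sdiff_subset
    have hsumB : ∑ X ∈ (H \ A) \ B, X.card + ∑ X ∈ B, X.card = ∑ X ∈ H \ A, X.card :=
      Finset.sum_sdiff hB
    have hC : (((H \ A) \ B).biUnion id).card =
        (H.biUnion id).card - (A.biUnion id).card - (B.biUnion id).card := by
      rw [hw _ (Finset.sdiff_subset.trans Finset.sdiff_subset), hw B hBH, hw A hA,
        hw H (Finset.Subset.refl _)]
      omega
    have hBle : (B.biUnion id).card ≤ (H.biUnion id).card - (A.biUnion id).card := by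
      rw [hw B hBH, hw A hA, hw H (Finset.Subset.refl _)]
      have := Finset.sum_le_sum_of_subset (f := fun X : Finset α => X.card) hB
      omega
    refine ⟨A, B, (H \ A) \ B, hA, hBH, Finset.sdiff_subset.trans Finset.sdiff_subset,
      Finset.disjoint_sdiff.mono_right hB, Finset.disjoint_sdiff.mono_right Finset.sdiff_subset,
      Finset.disjoint_sdiff, ?_, ?_⟩
    · rw [Finset.union_assoc, Finset.union_sdiff_of_subset hB, Finset.union_sdiff_of_subset hA]
    · rw [hC]
      refine ⟨⟨?_, ?_⟩, ⟨?_, ?_⟩, ⟨?_, ?_⟩⟩ <;> omega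

/-- Members of `F'_m` lie inside `U` when all members of `F` do. [folklore] -/
theorem subset_of_mem_disjUnions_downClosure {F : Finset (Finset α)} {U : Finset α}
    (hF : ∀ X ∈ F, X ⊆ U) {m : ℕ} {X : Finset α} (hX : X ∈ disjUnions (downClosure F) m) :
    X ⊆ U := by
  obtain ⟨H, hH, -, -, rfl⟩ := mem_disjUnions.1 hX
  exact Finset.biUnion_subset.2 fun Y hY => by
    obtain ⟨W, hW, hYW⟩ := mem_downClosure.1 (hH hY)
    exact hYW.trans (hF W hW)

/-- Three members of `F'_{t₁}, F'_{t₂}, F'_{t₃}` covering `U`, with `t₁ + t₂ + t₃ ≤ t`, give a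
cover of `U` by at most `t` members of `F` (the "conversely" direction of the reduction; no
disjointness or balance is needed). [cite: Pratt2024SCC, proof of Cor. 1.10] -/
theorem exists_cover_of_mem_disjUnions {F : Finset (Finset α)} {U : Finset α}
    (hF : ∀ X ∈ F, X ⊆ U) {t t₁ t₂ t₃ : ℕ} (ht : t₁ + t₂ + t₃ ≤ t) {X Y Z : Finset α}
    (hX : X ∈ disjUnions (downClosure F) t₁) (hY : Y ∈ disjUnions (downClosure F) t₂)
    (hZ : Z ∈ disjUnions (downClosure F) t₃) (hXYZ : X ∪ Y ∪ Z = U) :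
    ∃ G ⊆ F, G.card ≤ t ∧ G.biUnion id = U := by
  classical
  obtain ⟨H₁, hH₁, hc₁, -, rfl⟩ := mem_disjUnions.1 hX
  obtain ⟨H₂, hH₂, hc₂, -, rfl⟩ := mem_disjUnions.1 hY
  obtain ⟨H₃, hH₃, hc₃, -, rfl⟩ := mem_disjUnions.1 hZ
  have hsub : H₁ ∪ H₂ ∪ H₃ ⊆ downClosure F :=
    Finset.union_subset (Finset.union_subset hH₁ hH₂) hH₃
  have hU' : (H₁ ∪ H₂ ∪ H₃).biUnion id = U := by
    rw [Finset.union_biUnion, Finset.union_biUnion]; exact hXYZ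
  obtain ⟨G, hGF, hcard, hGU⟩ := exists_cover_of_subfamily_downClosure hF hsub hU'
  refine ⟨G, hGF, hcard.trans ?_, hGU⟩
  calc (H₁ ∪ H₂ ∪ H₃).card ≤ (H₁ ∪ H₂).card + H₃.card := Finset.card_union_le _ _
    _ ≤ H₁.card + H₂.card + H₃.card := by
        gcongr
        exact Finset.card_union_le _ _
    _ ≤ t := by omega

/-- **Pratt, proof of Cor. 1.10, second step**: "By the first paragraph, it now suffices to
check for every `(t₁, t₂, t₃)` with `t₁ + t₂ + t₃ ≤ t` if there exist
`X ∈ 𝓕'_{t₁}, Y ∈ 𝓕'_{t₂}, Z ∈ 𝓕'_{t₃}` partitioning `[n]`" — `F` has a cover of `U` by `≤ t`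
sets iff for some `t₁ + t₂ + t₃ ≤ t` three pairwise disjoint members of
`F'_{t₁}, F'_{t₂}, F'_{t₃}` (`disjUnions (downClosure F) tᵢ`) cover `U`, each of size within `s`
of `|U| / 3` (so the search may be restricted to unions of size `≤ |U|/3 + s`).
[cite: Pratt2024SCC, proof of Cor. 1.10] -/
theorem exists_cover_iff_exists_balanced_disjUnions (F : Finset (Finset α)) {U : Finset α}
    (hF : ∀ X ∈ F, X ⊆ U) {s : ℕ} (hs : ∀ X ∈ F, X.card ≤ s) (t : ℕ) :
    (∃ G ⊆ F, G.card ≤ t ∧ G.biUnion id = U) ↔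
      ∃ t₁ t₂ t₃ : ℕ, t₁ + t₂ + t₃ ≤ t ∧
        ∃ X ∈ disjUnions (downClosure F) t₁, ∃ Y ∈ disjUnions (downClosure F) t₂,
          ∃ Z ∈ disjUnions (downClosure F) t₃,
            Disjoint X Y ∧ Disjoint X Z ∧ Disjoint Y Z ∧ X ∪ Y ∪ Z = U ∧
            (U.card / 3 ≤ X.card + s ∧ X.card ≤ U.card / 3 + s) ∧
            (U.card / 3 ≤ Y.card + s ∧ Y.card ≤ U.card / 3 + s) ∧
            (U.card / 3 ≤ Z.card + s ∧ Z.card ≤ U.card / 3 + s) := by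
  classical
  constructor
  · intro hcov
    obtain ⟨H, hH, hHt, hd, hHU⟩ := (exists_cover_iff_exists_pairwiseDisjoint F hF t).1 hcov
    have hHs : ∀ X ∈ H, X.card ≤ s := fun X hX => card_le_of_mem_downClosure hs (hH hX)
    obtain ⟨A, B, C, hA, hB, hC, hAB, hAC, hBC, hABC, hbA, hbB, hbC⟩ :=
      exists_balanced_three_blocks H s hHs hd
    rw [hHU] at hbA hbB hbC
    have hmem : ∀ D ⊆ H, D.biUnion id ∈ disjUnions (downClosure F) D.card := fun D hD =>
      mem_disjUnions.2 ⟨D, hD.trans hH, rfl, hd.subset (Finset.coe_subset.2 hD), rfl⟩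
    have hdisj : ∀ D ⊆ H, ∀ E ⊆ H, Disjoint D E →
        Disjoint (D.biUnion id) (E.biUnion id) := by
      intro D hD E hE hDE
      rw [Finset.disjoint_biUnion_left]
      intro X hX
      rw [Finset.disjoint_biUnion_right]
      intro Y hY
      have hne : X ≠ Y := fun h => Finset.disjoint_left.1 hDE hX (h ▸ hY)
      exact hd (hD hX) (hE hY) hne
    have hcardH : A.card + B.card + C.card = H.card := by
      rw [← Finset.card_union_of_disjoint hAB,
        ← Finset.card_union_of_disjoint (Finset.disjoint_union_left.2 ⟨hAC, hBC⟩), hABC]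
    refine ⟨A.card, B.card, C.card, hcardH ▸ hHt, A.biUnion id, hmem A hA, B.biUnion id,
      hmem B hB, C.biUnion id, hmem C hC, hdisj A hA B hB hAB, hdisj A hA C hC hAC,
      hdisj B hB C hC hBC, ?_, hbA, hbB, hbC⟩
    rw [← Finset.union_biUnion, ← Finset.union_biUnion, hABC, hHU]
  · rintro ⟨t₁, t₂, t₃, ht, X, hX, Y, hY, Z, hZ, -, -, -, hXYZ, -, -, -⟩
    exact exists_cover_of_mem_disjUnions hF ht hX hY hZ hXYZ

/-! #### The boundary trick: one Balanced Tripartitioning instance per `(t₁, t₂, t₃, S, S₁, S₂, S₃)`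
-/

/-- The pruned family `𝓕'_t` of the proof of Cor. 1.10: the unions of `t` pairwise disjoint
members of `F'` "having size at most `n/3 + s`", and "remove from the resulting set family all
sets of size less than `⌊n/3⌋ − s`" (`n = |U|`; bounds in the `ℕ`-form of
`exists_balanced_three_blocks`). [cite: Pratt2024SCC, proof of Cor. 1.10] -/
def balancedDisjUnions (F : Finset (Finset α)) (U : Finset α) (s t : ℕ) : Finset (Finset α) :=
  (disjUnions (downClosure F) t).filter fun X =>
    U.card / 3 ≤ X.card + s ∧ X.card ≤ U.card / 3 + s

/-- Membership in the pruned family `𝓕'_t`, unfolded. [folklore] -/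
theorem mem_balancedDisjUnions {F : Finset (Finset α)} {U : Finset α} {s t : ℕ} {X : Finset α} :
    X ∈ balancedDisjUnions F U s t ↔ X ∈ disjUnions (downClosure F) t ∧
      U.card / 3 ≤ X.card + s ∧ X.card ≤ U.card / 3 + s := by
  simp only [balancedDisjUnions, Finset.mem_filter]

/-- The boundary family `𝓕''_{t,S}` of the proof of Cor. 1.10 for the boundary set `S` and
its part `Sᵢ = Si`: "`𝓕''_{tᵢ,S} = {X ∖ Sᵢ : X ∈ 𝓕'_{tᵢ}, |X| = n/3 − s + |Sᵢ|, X ∩ S = Sᵢ}`"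
(`n = |U|`, `𝓕'_t = balancedDisjUnions F U s t`). [cite: Pratt2024SCC, proof of Cor. 1.10] -/
def boundaryFamily (F : Finset (Finset α)) (U : Finset α) (s t : ℕ) (S Si : Finset α) :
    Finset (Finset α) :=
  ((balancedDisjUnions F U s t).filter fun X =>
      X.card = U.card / 3 - s + Si.card ∧ X ∩ S = Si).image fun X => X \ Si

/-- Membership in the boundary family `𝓕''_{t,S}` (part `Si`), unfolded. [folklore] -/
theorem mem_boundaryFamily {F : Finset (Finset α)} {U : Finset α} {s t : ℕ}
    {S Si X' : Finset α} :
    X' ∈ boundaryFamily F U s t S Si ↔ ∃ X ∈ balancedDisjUnions F U s t,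
      X.card = U.card / 3 - s + Si.card ∧ X ∩ S = Si ∧ X \ Si = X' := by
  simp only [boundaryFamily, Finset.mem_image, Finset.mem_filter]
  constructor
  · rintro ⟨X, ⟨hX, hc, hXS⟩, rfl⟩
    exact ⟨X, hX, hc, hXS, rfl⟩
  · rintro ⟨X, hX, hc, hXS, rfl⟩
    exact ⟨X, ⟨hX, hc, hXS⟩, rfl⟩

/-- "The sets `𝓕''_{tᵢ,S}` have equal size `⌊n/3⌋ − s` by construction" (proof of Cor. 1.10,
p. 7): members of a boundary family are `(|U|/3 − s)`-sets.
[cite: Pratt2024SCC, proof of Cor. 1.10] -/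
theorem card_eq_of_mem_boundaryFamily {F : Finset (Finset α)} {U : Finset α} {s t : ℕ}
    {S Si X' : Finset α} (h : X' ∈ boundaryFamily F U s t S Si) :
    X'.card = U.card / 3 - s := by
  obtain ⟨X, -, hcard, hXS, rfl⟩ := mem_boundaryFamily.1 h
  have hSX : Si ⊆ X := by rw [← hXS]; exact Finset.inter_subset_left
  rw [Finset.card_sdiff_of_subset hSX, hcard]
  omega

/-- The members of `𝓕''_{t,S}` are subsets of the new universe `U ∖ S` (so, with
`card_eq_of_mem_boundaryFamily`, three boundary families form a well-formed Balanced
Tripartitioning instance on `U ∖ S`, `|U ∖ S| = 3 (|U|/3 − s)`). [folklore] -/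
theorem subset_of_mem_boundaryFamily {F : Finset (Finset α)} {U : Finset α}
    (hF : ∀ X ∈ F, X ⊆ U) {s t : ℕ} {S Si X' : Finset α}
    (h : X' ∈ boundaryFamily F U s t S Si) : X' ⊆ U \ S := by
  obtain ⟨X, hXb, -, hXS, rfl⟩ := mem_boundaryFamily.1 h
  have hXU : X ⊆ U := subset_of_mem_disjUnions_downClosure hF (mem_balancedDisjUnions.1 hXb).1
  intro a ha
  rw [Finset.mem_sdiff] at ha ⊢
  refine ⟨hXU ha.1, fun haS => ha.2 ?_⟩
  rw [← hXS]
  exact Finset.mem_inter.2 ⟨ha.1, haS⟩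

/-- **Pratt, proof of Cor. 1.10, the boundary trick** ("If there were sets in
`𝓕'_{t₁}, 𝓕'_{t₂}, 𝓕'_{t₃}` partitioning `[n]`, then there exists an `S` such that
`𝓕''_{t₁,S}, 𝓕''_{t₂,S}, 𝓕''_{t₃,S}` contains a balanced tripartition of `[n] ∖ S`, and
conversely"), end to end: for a family `F` of `≤ s`-subsets of `U` with `3 ∣ |U|` and
`3s ≤ |U|`, `F` has a cover of `U` by `≤ t` sets iff for some `t₁ + t₂ + t₃ ≤ t`, some `S ⊆ U`
with `|S| = 3s` and some ordered partition `S = S₁ ⊔ S₂ ⊔ S₃`, three members of the boundary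
families `𝓕''_{t₁,S}` (part `S₁`), `𝓕''_{t₂,S}` (part `S₂`), `𝓕''_{t₃,S}` (part `S₃`) cover
`U ∖ S` — i.e. the Balanced Tripartitioning instance they form is a yes-instance (its members
are `(|U|/3 − s)`-sets, `card_eq_of_mem_boundaryFamily`). Forward: take `Sᵢ` of size
`|Xᵢ| − (|U|/3 − s)` inside the `i`-th balanced part; the sizes add up to `3s` because
`3 ∣ |U|`. [cite: Pratt2024SCC, proof of Cor. 1.10] -/
theorem exists_cover_iff_exists_boundary_tripartition (F : Finset (Finset α)) {U : Finset α}
    (hF : ∀ X ∈ F, X ⊆ U) {s : ℕ} (hs : ∀ X ∈ F, X.card ≤ s) (h3 : 3 ∣ U.card)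
    (h3s : 3 * s ≤ U.card) (t : ℕ) :
    (∃ G ⊆ F, G.card ≤ t ∧ G.biUnion id = U) ↔
      ∃ t₁ t₂ t₃ : ℕ, t₁ + t₂ + t₃ ≤ t ∧ ∃ S ⊆ U, S.card = 3 * s ∧
        ∃ S₁ S₂ S₃ : Finset α, Disjoint S₁ S₂ ∧ Disjoint S₁ S₃ ∧ Disjoint S₂ S₃ ∧
          S₁ ∪ S₂ ∪ S₃ = S ∧
          ∃ X ∈ boundaryFamily F U s t₁ S S₁, ∃ Y ∈ boundaryFamily F U s t₂ S S₂,
            ∃ Z ∈ boundaryFamily F U s t₃ S S₃, X ∪ Y ∪ Z = U \ S := by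
  classical
  constructor
  · intro hcov
    obtain ⟨t₁, t₂, t₃, ht, X, hX, Y, hY, Z, hZ, hXY, hXZ, hYZ, hXYZ, hbX, hbY, hbZ⟩ :=
      (exists_cover_iff_exists_balanced_disjUnions F hF hs t).1 hcov
    obtain ⟨hbX1, hbX2⟩ := hbX
    obtain ⟨hbY1, hbY2⟩ := hbY
    obtain ⟨hbZ1, hbZ2⟩ := hbZ
    have hn : X.card + Y.card + Z.card = U.card := by
      rw [← Finset.card_union_of_disjoint hXY,
        ← Finset.card_union_of_disjoint (Finset.disjoint_union_left.2 ⟨hXZ, hYZ⟩), hXYZ]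
    obtain ⟨S₁, hS₁X, hS₁c⟩ := Finset.exists_subset_card_eq
      (show X.card - (U.card / 3 - s) ≤ X.card from Nat.sub_le _ _)
    obtain ⟨S₂, hS₂Y, hS₂c⟩ := Finset.exists_subset_card_eq
      (show Y.card - (U.card / 3 - s) ≤ Y.card from Nat.sub_le _ _)
    obtain ⟨S₃, hS₃Z, hS₃c⟩ := Finset.exists_subset_card_eq
      (show Z.card - (U.card / 3 - s) ≤ Z.card from Nat.sub_le _ _)
    have hd₁₂ : Disjoint S₁ S₂ := hXY.mono hS₁X hS₂Y
    have hd₁₃ : Disjoint S₁ S₃ := hXZ.mono hS₁X hS₃Z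
    have hd₂₃ : Disjoint S₂ S₃ := hYZ.mono hS₂Y hS₃Z
    refine ⟨t₁, t₂, t₃, ht, S₁ ∪ S₂ ∪ S₃, ?_, ?_, S₁, S₂, S₃, hd₁₂, hd₁₃, hd₂₃, rfl, ?_⟩
    · rw [← hXYZ]
      exact Finset.union_subset_union (Finset.union_subset_union hS₁X hS₂Y) hS₃Z
    · rw [Finset.card_union_of_disjoint (Finset.disjoint_union_left.2 ⟨hd₁₃, hd₂₃⟩),
        Finset.card_union_of_disjoint hd₁₂]
      omega
    · have key : ∀ (W Sw : Finset α) (tw : ℕ), W ∈ disjUnions (downClosure F) tw →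
          U.card / 3 ≤ W.card + s → W.card ≤ U.card / 3 + s → Sw ⊆ W →
          Sw.card = W.card - (U.card / 3 - s) → W ∩ (S₁ ∪ S₂ ∪ S₃) = Sw →
          W \ Sw ∈ boundaryFamily F U s tw (S₁ ∪ S₂ ∪ S₃) Sw := by
        intro W Sw tw hW hbW1 hbW2 hSw hSwc hWS
        refine mem_boundaryFamily.2 ⟨W, mem_balancedDisjUnions.2 ⟨hW, hbW1, hbW2⟩, ?_, hWS, rfl⟩
        omega
      have hXS : X ∩ (S₁ ∪ S₂ ∪ S₃) = S₁ := by
        rw [Finset.inter_union_distrib_left, Finset.inter_union_distrib_left,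
          Finset.inter_eq_right.2 hS₁X,
          Finset.disjoint_iff_inter_eq_empty.1 (hXY.mono_right hS₂Y),
          Finset.disjoint_iff_inter_eq_empty.1 (hXZ.mono_right hS₃Z),
          Finset.union_empty, Finset.union_empty]
      have hYS : Y ∩ (S₁ ∪ S₂ ∪ S₃) = S₂ := by
        rw [Finset.inter_union_distrib_left, Finset.inter_union_distrib_left,
          Finset.inter_eq_right.2 hS₂Y,
          Finset.disjoint_iff_inter_eq_empty.1 (hXY.symm.mono_right hS₁X),
          Finset.disjoint_iff_inter_eq_empty.1 (hYZ.mono_right hS₃Z),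
          Finset.empty_union, Finset.union_empty]
      have hZS : Z ∩ (S₁ ∪ S₂ ∪ S₃) = S₃ := by
        rw [Finset.inter_union_distrib_left, Finset.inter_union_distrib_left,
          Finset.inter_eq_right.2 hS₃Z,
          Finset.disjoint_iff_inter_eq_empty.1 (hXZ.symm.mono_right hS₁X),
          Finset.disjoint_iff_inter_eq_empty.1 (hYZ.symm.mono_right hS₂Y),
          Finset.empty_union, Finset.empty_union]
      refine ⟨X \ S₁, key X S₁ t₁ hX hbX1 hbX2 hS₁X hS₁c hXS,
        Y \ S₂, key Y S₂ t₂ hY hbY1 hbY2 hS₂Y hS₂c hYS,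
        Z \ S₃, key Z S₃ t₃ hZ hbZ1 hbZ2 hS₃Z hS₃c hZS, ?_⟩
      have e : ∀ W Sw : Finset α, W ∩ (S₁ ∪ S₂ ∪ S₃) = Sw →
          W \ Sw = W \ (S₁ ∪ S₂ ∪ S₃) := by
        intro W Sw hWS
        rw [← hWS, Finset.sdiff_inter_self_left]
      rw [e X S₁ hXS, e Y S₂ hYS, e Z S₃ hZS, ← Finset.union_sdiff_distrib,
        ← Finset.union_sdiff_distrib, hXYZ]
  · rintro ⟨t₁, t₂, t₃, ht, S, hSU, -, S₁, S₂, S₃, -, -, -, hS, X', hX', Y', hY', Z', hZ',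
      hXYZ'⟩
    obtain ⟨X, hXb, -, hXS, rfl⟩ := mem_boundaryFamily.1 hX'
    obtain ⟨Y, hYb, -, hYS, rfl⟩ := mem_boundaryFamily.1 hY'
    obtain ⟨Z, hZb, -, hZS, rfl⟩ := mem_boundaryFamily.1 hZ'
    have hS₁X : S₁ ⊆ X := by rw [← hXS]; exact Finset.inter_subset_left
    have hS₂Y : S₂ ⊆ Y := by rw [← hYS]; exact Finset.inter_subset_left
    have hS₃Z : S₃ ⊆ Z := by rw [← hZS]; exact Finset.inter_subset_left
    refine exists_cover_of_mem_disjUnions hF ht (mem_balancedDisjUnions.1 hXb).1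
      (mem_balancedDisjUnions.1 hYb).1 (mem_balancedDisjUnions.1 hZb).1 ?_
    calc X ∪ Y ∪ Z = (X \ S₁ ∪ S₁) ∪ (Y \ S₂ ∪ S₂) ∪ (Z \ S₃ ∪ S₃) := by
          rw [Finset.sdiff_union_of_subset hS₁X, Finset.sdiff_union_of_subset hS₂Y,
            Finset.sdiff_union_of_subset hS₃Z]
      _ = (X \ S₁ ∪ Y \ S₂ ∪ Z \ S₃) ∪ (S₁ ∪ S₂ ∪ S₃) := by ac_rfl
      _ = U := by rw [hXYZ', hS, Finset.sdiff_union_of_subset hSU]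

end SetCoverReduction

end Literature.Computability.AlgebraicComplexity
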